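import Summits.Ventures.HSemireg.WedgeHankelBoxKernel
import Summits.Ventures.HSemireg.WedgeKunnethKernelFlat

/-!
# Venture HSemireg — THE KERNEL OF EVERY HANKEL BOX IN EVERY DEGREE, NAMED (flat form):
# `ker(θ ↦ θ ∧ (v₀ ∧ ⋯ ∧ v_{n−1}) ∣ ⋀^k) = Σ_i Σ_{b ≤ k} Kr(block_i, v_i, b) ∧ Hom(other blocks, k − b)`; degree 3 for non-pure classes

HONEST FRAMING. Part of the Lean index of the computation cell `pub-hsemireg` (seat p10 gen 13, Sunday typer «UNIFORM-IN-n»).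
Finite-dimensional EXTERIOR ALGEBRA over a field and ranks of HANKEL MATRICES ONLY: no variety, no cohomology theory, no sheaf,
no Ext group and no semiregularity map is constructed here; nothing here says that HC / HC_CM / HC_AV holds; no Literature fact is
declared or used.  Custodian versions cited: theory/FORMULA-N.md PART A §2.3 THEOREM K, §2.6 THEOREM H, FN-4 (i); PART B §N; th-7
Cor. A.4; STRUCTURE.md v1.0-SIGNED 9b196a05977dd067 §1.1 C4 / C10 / C15.  The dictionary (`v_i = Σ_j (q_i)_j Θ_i^j/j!` ↦ `w_{m_i}(q_i)` in
block `i`; `⌟(v₀ ⊠ ⋯ ⊠ v_{n−1})` on `HT^k(X₀ × ⋯ × X_{n−1})` ↦ `θ ↦ θ ∧ F_q` on `⋀^k`) is QUOTED, never asserted.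

WHAT IS KEYED.  `WedgeKunnethKernelFlat` (C4): THE FLAT KÜNNETH KERNEL LAW over any finite splitting, `Kr(⋃_{i<j} D_i, f 0 ∧ ⋯ ∧ f (j−1), k)
= Σ_{i<j} T j i k`, `T j i k = Σ_{b ≤ k} Kr(D_i, f_i, b) ∧ Hom(oth j i, k − b)`; `WedgeHankelBoxKernel` (C3): the one-factor kernel spaces of a
Hankel class (`dim Kr(univ, w_m(q), a) = C(2m, a) − C(m, a)·rank H_a(q)`), their block transport, and the degree-`≤ 2` kernel of a box of
non-pure classes.  THIS FILE puts them together for gen 10's Hankel box `F_q = v₀ ∧ ⋯ ∧ v_{n−1}` on the mixed generators `Σₗ i, Fin (m_i + m_i)`: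
* §1 **`Kr_hankelBox_eq_iSup_T` / `ker_wedge_hankelBox_eq`: `ker(θ ↦ θ ∧ F_q ∣ ⋀^k) = Σ_{i<n} Σ_{b ≤ k} Kr(block_i, v_i, b) ∧ Hom(other
  blocks, k − b)`** for EVERY field, `n ≥ 1`, dimensions `m_i`, classes `q_i` and degree `k` — THE NAME OF THE KERNEL OF EVERY HANKEL BOX:
  a `k`-form kills the box iff it is a sum of forms each killing ONE factor's class (times anything on the other factors); the factor
  kernel spaces are the embedded one-factor ones (`T_hankelBox_eq_map`), of dimensions `C(2m_i, b) − C(m_i, b)·rank H_b(q_i)` (C3).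
* §2 NON-PURE CLASSES (`rank H_1(q_i) = 2`, `m_i ≥ 1`): the factor terms start in degree `2` (`Kr_hfac_zero_eq_bot`, C3's
  `Kr_hfac_one_eq_bot`), so **`Kr_hankelBox_three`: `Kr(univ, F_q, 3) = Σ_i ( Kr(block_i, v_i, 2) ∧ Hom(other blocks, 1) + Kr(block_i, v_i, 3) )`**
  — the degree-3 kernel of a box of non-pure classes is the factors' degree-3 kernels plus the factors' degree-2 kernels times the
  `1`-forms of the other factors, and nothing else (every field, `n ≥ 1`, dimensions, such classes).
* §3 NON-ZERO classes (no rank hypothesis): the box is non-zero (`hankelBox_ne_zero_of_ne_zero`) and **`Kr_hankelBox_one_eq` /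
  `ker_wedge_hankelBox_one_eq`: the `1`-forms killing the box are exactly the factors' own, `ker(θ ↦ θ ∧ F_q ∣ ⋀¹) = ⊔_i emb_i Kr(univ, w_{m_i}(q_i), 1)`**
  (dimension `Σ_i (2m_i − m_i·rank H_1(q_i))` by C3), `hankelBox_ne_zero_iff`, **`Kr_hankelBox_one_eq_bot_iff` (a box of non-zero classes is non-degenerate
  iff every factor is — iff no class is pure)**; and **`Kr_hankelBox_two_of_ne_zero`: the degree-2 kernel of
  EVERY box of non-zero classes (pure factors allowed) = `Σ_i ( Kr(block_i,v_i,1) ∧ Hom(other blocks,1) + Kr(block_i,v_i,2) )`**.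
In the quoted dictionary: for any external product `E₀ ⊠ ⋯ ⊠ E_{n−1}` of `K[Θ_i]`-class objects, `ker(⌟ch(E) ∣ HT^k)` is generated by the
factors' own kernels; for generic factors (full Hankel ranks) those are gen 11's Siegel ideals and the sum is gen 12's box Siegel ideal
(its FULL-RANK CRITERION, read backwards); for pure factors (line-bundle-like classes) the factor kernel is the ideal of the class's linear
forms (by value through `Kr`).  NOT typed here: dimensions of the flat terms' overlaps; anything Ext-side.  Class side only.
Namespace `Summit.Ventures.HSemireg.Wedge.HankelBoxKernel` (continued); new names only.
-/

open Module

namespace Summit.Ventures.HSemireg.Wedge.HankelBoxKernel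

open Summit.Ventures.HSemireg.Wedge Summit.Ventures.HSemireg.Wedge.Kunneth Summit.Ventures.HSemireg.Wedge.MixedBox
  Summit.Ventures.HSemireg.Wedge.KunnethKernel Summit.Ventures.HSemireg.Wedge.HankelBox

variable (K : Type*) [Field K]

section Box

variable {n : ℕ} (m : Fin n → ℕ)

/-! ## §1. The kernel of every Hankel box in every degree -/

/-- **THE KERNEL OF EVERY HANKEL BOX IN EVERY DEGREE, NAMED: `Kr(univ, F_q, k) = Σ_{i<n} Σ_{b ≤ k} Kr(block_i, v_i, b) ∧ Hom(other blocks, k − b)`**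
(`n ≥ 1`; every field, dimensions, classes, degree). -/
theorem Kr_hankelBox_eq_iSup_T (hn : 1 ≤ n) (q : Fin n → ℕ → K) (k : ℕ) :
    Kr K Finset.univ (hankelBox K m q) k = ⨆ i : Fin n, T K (blk m) (hfac K m q) n i k := by
  have h := Kr_prodR_eq_iSup_T K (hfac_mem_Hom' K m q) (blk_disjoint m) n hn le_rfl k
  rw [hankelBox, ← iSup_range_eq_iSup_fin K m (fun i => T K (blk m) (hfac K m q) n i k), ← h]
  refine Kr_univ_eq_Kr_biUnion K m _ k _ fun x => ?_
  simp only [Finset.mem_biUnion, Finset.mem_range]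
  exact exists_mem_blk m x

/-- **WEDGE FORM: `ker(θ ↦ θ ∧ F_q ∣ ⋀^k) = Σ_{i<n} Σ_{b ≤ k} Kr(block_i, v_i, b) ∧ Hom(other blocks, k − b)`** for every Hankel box. -/
theorem ker_wedge_hankelBox_eq (hn : 1 ≤ n) (q : Fin n → ℕ → K) (k : ℕ) :
    LinearMap.ker (wedge K (Gen m) k (hankelBox K m q)) =
      (⨆ i : Fin n, T K (blk m) (hfac K m q) n i k).comap (⋀[K]^k (Gen m → K)).subtype := by
  rw [ker_wedge_eq_comap_Kr, Kr_hankelBox_eq_iSup_T K m hn q k]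

/-- the factor terms with the one-factor kernel spaces made explicit:
**`T n i k = Σ_{b ≤ k} emb_i( Kr(univ, w_{m_i}(q_i), b) ) ∧ Hom(other blocks, k − b)`**. -/
theorem T_hankelBox_eq_map (q : Fin n → ℕ → K) (i : Fin n) (k : ℕ) :
    T K (blk m) (hfac K m q) n i k =
      ⨆ b ∈ Finset.range (k + 1), (Kr K Finset.univ (Hankel.w K (m i) (m i) (q i)) b).map (emb K (facEmb m i)).toLinearMap *
        Hom K (Gen m) (oth (blk m) n i) (k - b) := by
  rw [T]
  exact iSup_congr fun b => iSup_congr fun _ => by rw [map_emb_Kr]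

/-- the easy half, for the record: a form killing ONE factor's class (times anything on the other factors) kills the box. -/
theorem Kr_hfac_mul_Hom_le (hn : 1 ≤ n) (q : Fin n → ℕ → K) (i : Fin n) {b k : ℕ} (hbk : b ≤ k) :
    Kr K (blk m i) (hfac K m q i) b * Hom K (Gen m) (oth (blk m) n i) (k - b) ≤ Kr K Finset.univ (hankelBox K m q) k := by
  rw [Kr_hankelBox_eq_iSup_T K m hn q k]
  refine le_iSup_of_le i (le_iSup₂_of_le b (Finset.mem_range.mpr (by omega)) le_rfl)

/-! ## §2. Non-pure classes: the factor terms start in degree 2; degree 3 named -/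

/-- a factor of Hankel rank `2` in degree `1` is killed by no scalar on the box generators. -/
theorem Kr_hfac_zero_eq_bot {q : Fin n → ℕ → K} {i : Fin n} (hm : 1 ≤ m i) (h1 : (Hankel.hankel1 K (m i) 1 (q i)).rank = 2) :
    Kr K (blk m i) (hfac K m q i) 0 = ⊥ :=
  Kr_zero_eq_bot K _ (hfac_ne_zero K m hm h1)

/-- the factor term of a non-pure class in degree `3` has only its `b = 2` and `b = 3` summands. -/
lemma T_three_eq {q : Fin n → ℕ → K} {i : Fin n} (hm : 1 ≤ m i) (h1 : (Hankel.hankel1 K (m i) 1 (q i)).rank = 2) (j : ℕ) :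
    T K (blk m) (hfac K m q) j i 3 =
      Kr K (blk m i) (hfac K m q i) 2 * Hom K (Gen m) (oth (blk m) j i) 1 ⊔ Kr K (blk m i) (hfac K m q i) 3 * Hom K (Gen m) (oth (blk m) j i) 0 := by
  rw [T, ← Finset.sup_eq_iSup]
  simp only [Finset.range_add_one, Finset.range_zero, Finset.sup_insert, Finset.insert_empty, Finset.sup_singleton,
    Kr_hfac_zero_eq_bot K m hm h1, Kr_hfac_one_eq_bot K m hm h1, Submodule.bot_mul, sup_bot_eq, Nat.sub_self,
    show 3 - 2 = 1 from rfl]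
  rw [sup_comm]

/-- **THE DEGREE-3 KERNEL OF A BOX OF NON-PURE CLASSES, NAMED: `Kr(univ, F_q, 3) = Σ_i ( Kr(block_i, v_i, 2) ∧ Hom(other blocks, 1) +
Kr(block_i, v_i, 3) )`** (`n ≥ 1`, `m_i ≥ 1`, `rank H_1(q_i) = 2` for all `i`): the factors' degree-3 kernels plus the factors' degree-2
kernels times the `1`-forms of the other factors, and nothing else. -/
theorem Kr_hankelBox_three (hn : 1 ≤ n) (hm : ∀ i, 1 ≤ m i) {q : Fin n → ℕ → K}
    (h1 : ∀ i, (Hankel.hankel1 K (m i) 1 (q i)).rank = 2) :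
    Kr K Finset.univ (hankelBox K m q) 3 =
      ⨆ i : Fin n, (Kr K (blk m i) (hfac K m q i) 2 * Hom K (Gen m) (oth (blk m) n i) 1 ⊔ Kr K (blk m i) (hfac K m q i) 3) := by
  rw [Kr_hankelBox_eq_iSup_T K m hn q 3]
  refine iSup_congr fun i => ?_
  rw [T_three_eq K m (hm i) (h1 i), Hom_zero_eq_one, Submodule.mul_one]

/-- wedge form of the degree-3 name. -/
theorem ker_wedge_hankelBox_three (hn : 1 ≤ n) (hm : ∀ i, 1 ≤ m i) {q : Fin n → ℕ → K}
    (h1 : ∀ i, (Hankel.hankel1 K (m i) 1 (q i)).rank = 2) :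
    LinearMap.ker (wedge K (Gen m) 3 (hankelBox K m q)) =
      (⨆ i : Fin n, (Kr K (blk m i) (hfac K m q i) 2 * Hom K (Gen m) (oth (blk m) n i) 1 ⊔ Kr K (blk m i) (hfac K m q i) 3)).comap
        (⋀[K]^3 (Gen m → K)).subtype := by
  rw [ker_wedge_eq_comap_Kr, Kr_hankelBox_three K m hn hm h1]

/-! ## §3. Degrees 0 and 1 for every box of non-zero classes -/

/-- a non-zero class stays non-zero on the box generators. -/
lemma hfac_ne_zero_of_ne_zero {q : Fin n → ℕ → K} {i : Fin n} (h0 : Hankel.w K (m i) (m i) (q i) ≠ 0) : hfac K m q i ≠ 0 := by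
  rw [hfac_fin, ← map_zero (emb K (facEmb m i))]
  exact fun h => h0 (emb_injective K (facEmb m i) h)

/-- **a Hankel box of NON-ZERO classes is non-zero** (`F_q ≠ 0`; every field, `n`, dimensions). -/
theorem hankelBox_ne_zero_of_ne_zero {q : Fin n → ℕ → K} (h0 : ∀ i, Hankel.w K (m i) (m i) (q i) ≠ 0) : hankelBox K m q ≠ 0 :=
  prodR_ne_zero K (hfac_mem_Hom' K m q) (blk_disjoint m) (fun i hi => hfac_ne_zero_of_ne_zero K m (i := ⟨i, hi⟩) (h0 _)) le_rfl

/-- **THE 1-FORMS KILLING A HANKEL BOX OF NON-ZERO CLASSES ARE THE FACTORS' OWN: `Kr(univ, F_q, 1) = ⊔_i emb_i( Kr(univ, w_{m_i}(q_i), 1) )`**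
(`n ≥ 1`; every field, dimensions, non-zero classes) — of dimension `Σ_i (2m_i − m_i·rank H_1(q_i))` factor by factor (C3); zero iff no class is pure. -/
theorem Kr_hankelBox_one_eq (hn : 1 ≤ n) {q : Fin n → ℕ → K} (h0 : ∀ i, Hankel.w K (m i) (m i) (q i) ≠ 0) :
    Kr K Finset.univ (hankelBox K m q) 1 =
      ⨆ i : Fin n, (Kr K Finset.univ (Hankel.w K (m i) (m i) (q i)) 1).map (emb K (facEmb m i)).toLinearMap := by
  have h := Kr_prodR_one_eq K (hfac_mem_Hom' K m q) (blk_disjoint m)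
    (fun i hi => hfac_ne_zero_of_ne_zero K m (i := ⟨i, hi⟩) (h0 _)) hn le_rfl
  have e : (⨆ i : Fin n, (Kr K Finset.univ (Hankel.w K (m i) (m i) (q i)) 1).map (emb K (facEmb m i)).toLinearMap) =
      ⨆ i : Fin n, Kr K (blk m i) (hfac K m q i) 1 := iSup_congr fun i => map_emb_Kr K m q i 1
  rw [e, hankelBox, ← iSup_range_eq_iSup_fin K m (fun i => Kr K (blk m i) (hfac K m q i) 1), ← h]
  refine Kr_univ_eq_Kr_biUnion K m _ 1 _ fun x => ?_
  simp only [Finset.mem_biUnion, Finset.mem_range]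
  exact exists_mem_blk m x

/-- wedge form: **`ker(θ ↦ θ ∧ F_q ∣ ⋀¹) = ⊔_i emb_i( Kr(univ, w_{m_i}(q_i), 1) )`** for every box of non-zero classes. -/
theorem ker_wedge_hankelBox_one_eq (hn : 1 ≤ n) {q : Fin n → ℕ → K} (h0 : ∀ i, Hankel.w K (m i) (m i) (q i) ≠ 0) :
    LinearMap.ker (wedge K (Gen m) 1 (hankelBox K m q)) =
      (⨆ i : Fin n, (Kr K Finset.univ (Hankel.w K (m i) (m i) (q i)) 1).map (emb K (facEmb m i)).toLinearMap).comap
        (⋀[K]^1 (Gen m → K)).subtype := by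
  rw [ker_wedge_eq_comap_Kr, Kr_hankelBox_one_eq K m hn h0]

/-- conversely **a box with a ZERO class is zero**: `w_{m_i}(q_i) = 0 ⇒ F_q = 0`. -/
theorem hankelBox_eq_zero_of_eq_zero {q : Fin n → ℕ → K} {i : Fin n} (h0 : Hankel.w K (m i) (m i) (q i) = 0) : hankelBox K m q = 0 := by
  have hstep : ∀ j, (i : ℕ) < j → prodR K (hfac K m q) j = 0 := by
    intro j hj
    induction j with
    | zero => omega
    | succ j ih =>
      rw [prodR_succ]
      rcases Nat.lt_or_ge (i : ℕ) j with h | h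
      · rw [ih h, zero_mul]
      · have hij : (i : ℕ) = j := by omega
        rw [← hij, hfac_fin, h0, map_zero, mul_zero]
  exact hstep n i.2

/-- so **a Hankel box is non-zero iff every class is non-zero**. -/
theorem hankelBox_ne_zero_iff (q : Fin n → ℕ → K) : hankelBox K m q ≠ 0 ↔ ∀ i, Hankel.w K (m i) (m i) (q i) ≠ 0 :=
  ⟨fun h _ h0 => h (hankelBox_eq_zero_of_eq_zero K m h0), hankelBox_ne_zero_of_ne_zero K m⟩

/-- **A BOX OF NON-ZERO CLASSES IS NON-DEGENERATE IFF EVERY FACTOR IS: `Kr(univ, F_q, 1) = 0 ⟺ ∀ i, Kr(univ, w_{m_i}(q_i), 1) = 0`**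
(with C3's `Kr_w_one_eq_bot_iff`: iff every `rank H_1(q_i) = 2`, i.e. no class is pure). -/
theorem Kr_hankelBox_one_eq_bot_iff (hn : 1 ≤ n) {q : Fin n → ℕ → K} (h0 : ∀ i, Hankel.w K (m i) (m i) (q i) ≠ 0) :
    Kr K Finset.univ (hankelBox K m q) 1 = ⊥ ↔ ∀ i, Kr K Finset.univ (Hankel.w K (m i) (m i) (q i)) 1 = ⊥ := by
  rw [Kr_hankelBox_one_eq K m hn h0, iSup_eq_bot]
  refine forall_congr' fun i => ⟨fun h => ?_, fun h => by rw [h, Submodule.map_bot]⟩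
  rw [eq_bot_iff]
  intro x hx
  have hx' : (emb K (facEmb m i)).toLinearMap x ∈ (Kr K Finset.univ (Hankel.w K (m i) (m i) (q i)) 1).map (emb K (facEmb m i)).toLinearMap :=
    Submodule.mem_map_of_mem hx
  rw [h, Submodule.mem_bot, AlgHom.toLinearMap_apply, ← map_zero (emb K (facEmb m i))] at hx'
  rw [Submodule.mem_bot]
  exact emb_injective K (facEmb m i) hx'

/-- the factor term of a NON-ZERO class in degree `2`: `T j i 2 = Kr(block_i, v_i, 1) ∧ Hom(other blocks, 1) ⊔ Kr(block_i, v_i, 2)` (the `b = 0`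
summand vanishes). -/
lemma T_two_eq_of_ne_zero {q : Fin n → ℕ → K} {i : Fin n} (h0 : Hankel.w K (m i) (m i) (q i) ≠ 0) (j : ℕ) :
    T K (blk m) (hfac K m q) j i 2 =
      Kr K (blk m i) (hfac K m q i) 1 * Hom K (Gen m) (oth (blk m) j i) 1 ⊔ Kr K (blk m i) (hfac K m q i) 2 := by
  rw [T, ← Finset.sup_eq_iSup]
  simp only [Finset.range_add_one, Finset.range_zero, Finset.sup_insert, Finset.insert_empty, Finset.sup_singleton,
    Kr_zero_eq_bot K _ (hfac_ne_zero_of_ne_zero K m h0), Submodule.bot_mul, sup_bot_eq, Nat.sub_self, show 2 - 1 = 1 from rfl,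
    Hom_zero_eq_one, Submodule.mul_one]
  rw [sup_comm]

/-- **THE DEGREE-2 KERNEL OF EVERY BOX OF NON-ZERO CLASSES (pure factors allowed), NAMED:
`Kr(univ, F_q, 2) = Σ_i ( Kr(block_i, v_i, 1) ∧ Hom(other blocks, 1) + Kr(block_i, v_i, 2) )`** (`n ≥ 1`; every field, dimensions, non-zero
classes) — the factors' degree-2 kernels plus, for each factor killed by `1`-forms (the PURE ones, `WedgeHankelPureKernel`), those `1`-forms
times the `1`-forms of the other factors; for non-pure factors the first summand is `0` and C3's direct sum is recovered. -/
theorem Kr_hankelBox_two_of_ne_zero (hn : 1 ≤ n) {q : Fin n → ℕ → K} (h0 : ∀ i, Hankel.w K (m i) (m i) (q i) ≠ 0) :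
    Kr K Finset.univ (hankelBox K m q) 2 =
      ⨆ i : Fin n, (Kr K (blk m i) (hfac K m q i) 1 * Hom K (Gen m) (oth (blk m) n i) 1 ⊔ Kr K (blk m i) (hfac K m q i) 2) := by
  rw [Kr_hankelBox_eq_iSup_T K m hn q 2]
  exact iSup_congr fun i => T_two_eq_of_ne_zero K m (h0 i) n

/-- wedge form: `ker(θ ↦ θ ∧ F_q ∣ ⋀²)` for every box of non-zero classes. -/
theorem ker_wedge_hankelBox_two_of_ne_zero (hn : 1 ≤ n) {q : Fin n → ℕ → K} (h0 : ∀ i, Hankel.w K (m i) (m i) (q i) ≠ 0) :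
    LinearMap.ker (wedge K (Gen m) 2 (hankelBox K m q)) =
      (⨆ i : Fin n, (Kr K (blk m i) (hfac K m q i) 1 * Hom K (Gen m) (oth (blk m) n i) 1 ⊔ Kr K (blk m i) (hfac K m q i) 2)).comap
        (⋀[K]^2 (Gen m → K)).subtype := by
  rw [ker_wedge_eq_comap_Kr, Kr_hankelBox_two_of_ne_zero K m hn h0]

end Box

end Summit.Ventures.HSemireg.Wedge.HankelBoxKernel
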